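/-
Copyright (c) 2026 the pub-hodgecm-mathlib formalisation cell (harness21).  Prover seat hodgecm-mathlib-K2E1-p06 (g2): Track B «K2-LIT»,
h413 = stmt-HodgeConjecture-24833, chair K2-lead (g0), dealer K2E1-plan (g0) deal 2026-09-03T22:49:05Z (row 14, third rung); 2026-09-03.
-/
import Summits.HodgeConjecture.HodgeConjecture.Theorems.K2E1EigenvaluePackageOfSpherical
import HarnessLib

/-!
# Crux `H413`, Track B road `K2_E1` «TraceFormulaBeta» — `K2E1EvpTransferXiH`: the transfer `t ↦ ψ_G(t)` of eigenvalue packages along the dual Hecke maps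
# `b_v = ξ̂_{H,v} : ℋ(G_v, K_v) → ℋ(H_v, K_{H,v})`, its `hat`-law, and the defining trace identity `IsXiHDual` tying `b` to the lift of unramified classes
(Rogawski (1990), §13.6 p. 209: «a map `ψ` of L-groups defines a transfer `t → ψ(t)` of e.v.p.'s»; §4.5 p. 46: «`η̂ : ℋ(G, ω) → ℋ(H, ωμ⁻¹)` … such that
`Tr(π_{χ′}(η̂(f))) = Tr(π_χ(f))` if `π_{χ′}` maps to `π_χ`»; §13.8 p. 218 «`ψ_G(t(ρ)) = t`»)

Cell `hodgecm-mathlib`, crux item h413 = `stmt-HodgeConjecture-24833`, route `HCCMUnconditional`; squad K2, dealer K2E1-plan (g0) (row 14 of the K2·E1 TABLE,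
third rung over ★ p855362 `K2E1EigenvaluePackageOfSpherical` ∕ ★ p855414 `K2E1EvpOfAutomorphicClass`).  DEFINITIONS WITH BODIES + API; the dual Hecke maps
`b_v` are a NAMED PARAMETER family of algebra homomorphisms (print DEFINES `η̂` through the Satake isomorphism; the tree posits it abstractly in ★
`Rogawski1990.Ch4Sec3to5.UnramifiedDatum.etaHat`∕`EtaHatSpec` and proves Satake only for `GL_n` ∕ hyperspecial unitary groups — no concrete `ξ̂_H` between
the tree's `heckeAlgebra`s tonight), and their defining property is the PREDICATE WITH PARAMETERS `IsXiHDual` (not a named fact).  No instance, no notation,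
no `sorry`; lane `--supports stmt-HodgeConjecture-24833 --as helper`.

GENERIC in the place index `ι`, the exceptional set `S`, two families of local groups `GG v` («`G_v`»), `GH v` («`H_v`», e.g. `U(2) × U(1)`) with levels
`KG v`, `KH v`, so that the K2·E1 instance is pure instantiation (`GG v = (cmDatum L 3 H).Local v`, `KG v = cmLocalIntegralLevel L 3 H v`, `GH v = HLoc L v`):
* §1 `psiG b t := t.transfer b` (★ `Ch13Sec6.EigenvaluePackage.transfer`) for `b_v : ℋ(G_v, K_{G,v}) →ₐ[ℂ] ℋ(H_v, K_{H,v})`, `v ∉ S`; `psiG_apply`;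
  **`hat_psiG : (ψ_G t)^∧(f) = t^∧(b f)`** (★ `hat` is a `finprod`); functoriality `psiG_comp` (transfer along a composite = composite of transfers).
* §2 **`IsXiHDual KG KH lift b`** — «for every `K_{H,v}`-spherical class `ρ_v` of `H_v` whose lift `lift v ρ_v` is `K_{G,v}`-spherical,
  `χ_{lift ρ_v}(op f) = χ_{ρ_v}(op (b_v f))` for all `f ∈ ℋ(G_v, K_{G,v})`» (the spherical characters of ★ p855362; = print's `Tr(π_{χ′}(η̂ f)) = Tr(π_χ(f))`
  read on the spherical lines), and the LAW it buys: **`evp_lift_eq_psiG_evp`** — the e.v.p. of the lifted family IS the transfer of the e.v.p.: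
  `t(lift ∘ ρ) = ψ_G(t(ρ))` in ★ `EigenvaluePackage S (fun v => (heckeAlgebra ℂ (GG v) (KG v))ᵐᵒᵖ)` (with the `ᵐᵒᵖ`-valued `evp` of ★ p855362; the un-opped
  reading of ★ p855414 `evpOfClass` is the same numbers), whence `hat_evp_lift` — «`ψ_G(t(ρ)) = t`» of (13.8.3) as an identity of `hat`-values.

HONEST LABEL.  Bookkeeping over a NAMED `b` and the predicate `IsXiHDual`; no Satake transform is constructed; closes no socket; `HC_CM` is proved only
modulo the 7 printed citations (2 remaining named inputs: hLiu418 = `stmt-HodgeConjecture-24832`, h413 = `stmt-HodgeConjecture-24833`) until rung 0 closes.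

## References
* [Rogawski1990] J. D. Rogawski, *Automorphic Representations of Unitary Groups in Three Variables*, Ann. of Math. Stud. 123 (1990), §4.5 pp. 45–46, §13.6
  p. 209, §13.8 p. 218.
* [CartierCorvallis1979] P. Cartier, *Representations of p-adic groups: a survey*, PSPM 33.1 (1979), §IV.1 Cor. 4.1–4.2.
-/

set_option autoImplicit false
set_option linter.dupNamespace false

noncomputable section

open Literature.NumberTheory.Automorphic Literature.NumberTheory.Rogawski1990
open Summit.HodgeConjecture.HodgeConjecture.Cruxes.H413.K2E1EigenvaluePackageOfSpherical

universe u v w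

namespace Summit.HodgeConjecture.HodgeConjecture.Cruxes.H413.K2E1EvpTransferXiH

/-! ## §1 The transfer `ψ_G` of eigenvalue packages along dual Hecke maps and its `hat`-law -/

section Transfer

variable {ι : Type u} {S : Set ι} {𝓗G : ι → Type v} {𝓗H : ι → Type w}
  [∀ i, Semiring (𝓗G i)] [∀ i, Algebra ℂ (𝓗G i)] [∀ i, Semiring (𝓗H i)] [∀ i, Algebra ℂ (𝓗H i)]

/-- **`ψ_G(t)`**: the transfer of an eigenvalue package `t` of `H` to one of `G` along the dual Hecke maps `b_v : 𝓗_{G,v} → 𝓗_{H,v}` (`v ∉ S`),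
`ψ_G(t)_v = t_v ∘ b_v` — ★ `Ch13Sec6.EigenvaluePackage.transfer` named for the L-map `ξ_H` (Rogawski §13.6: «a map `ψ` of L-groups defines a transfer
`t → ψ(t)` of e.v.p.'s»). [cite: Rogawski1990, §13.6 p. 209] -/
def psiG (b : ∀ i : {i : ι // i ∉ S}, 𝓗G i.1 →ₐ[ℂ] 𝓗H i.1) (t : Ch13Sec6.EigenvaluePackage S 𝓗H) : Ch13Sec6.EigenvaluePackage S 𝓗G :=
  t.transfer b

/-- Unfolding: `ψ_G(t)_v f = t_v (b_v f)`. [cite: Rogawski1990, §13.6 p. 209] -/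
@[simp] theorem psiG_apply (b : ∀ i : {i : ι // i ∉ S}, 𝓗G i.1 →ₐ[ℂ] 𝓗H i.1) (t : Ch13Sec6.EigenvaluePackage S 𝓗H) (i : {i : ι // i ∉ S}) (f : 𝓗G i.1) :
    psiG b t i f = t i (b i f) :=
  rfl

/-- **`(ψ_G t)^∧(f) = t^∧(b f)`**: the `hat` of the transferred package at `f = ⊗ f_v` is the `hat` of `t` at `⊗ b_v(f_v)` (★ `hat` is the `finprod` of the
local values). [cite: Rogawski1990, §13.6 p. 209] -/
theorem hat_psiG (b : ∀ i : {i : ι // i ∉ S}, 𝓗G i.1 →ₐ[ℂ] 𝓗H i.1) (t : Ch13Sec6.EigenvaluePackage S 𝓗H) (f : ∀ i : {i : ι // i ∉ S}, 𝓗G i.1) :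
    (psiG b t).hat f = t.hat fun i => b i (f i) :=
  rfl

/-- Functoriality: transferring along `b` and then along `b′` is transferring along the composites `b_v ∘ b′_v`. [cite: Rogawski1990, §13.6 p. 209] -/
theorem psiG_psiG {𝓗G' : ι → Type*} [∀ i, Semiring (𝓗G' i)] [∀ i, Algebra ℂ (𝓗G' i)]
    (b' : ∀ i : {i : ι // i ∉ S}, 𝓗G' i.1 →ₐ[ℂ] 𝓗G i.1) (b : ∀ i : {i : ι // i ∉ S}, 𝓗G i.1 →ₐ[ℂ] 𝓗H i.1) (t : Ch13Sec6.EigenvaluePackage S 𝓗H) :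
    psiG b' (psiG b t) = psiG (fun i => (b i).comp (b' i)) t :=
  rfl

/-- Two packages agreeing at almost all places (★ `AgreeAlmostEverywhere`) stay so after transfer. [cite: Rogawski1990, §13.6 p. 209] -/
theorem psiG_agreeAlmostEverywhere (b : ∀ i : {i : ι // i ∉ S}, 𝓗G i.1 →ₐ[ℂ] 𝓗H i.1) {t t' : Ch13Sec6.EigenvaluePackage S 𝓗H}
    (h : t.AgreeAlmostEverywhere t') : (psiG b t).AgreeAlmostEverywhere (psiG b t') := by
  refine Set.Finite.subset h fun i hi => ?_
  simp only [Set.mem_setOf_eq] at hi ⊢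
  intro hti
  exact hi (by rw [psiG, psiG, Ch13Sec6.EigenvaluePackage.transfer, Ch13Sec6.EigenvaluePackage.transfer, hti])

end Transfer

/-! ## §2 The defining trace identity of the dual maps and the law `t(lift ∘ ρ) = ψ_G(t(ρ))` -/

section Dual

variable {ι : Type u} {S : Set ι} (GG : ι → Type u) (GH : ι → Type u)
  [∀ i, Group (GG i)] [∀ i, TopologicalSpace (GG i)] [∀ i, Group (GH i)] [∀ i, TopologicalSpace (GH i)]
  (KG : ∀ i, Subgroup (GG i)) (KH : ∀ i, Subgroup (GH i))
  (lift : ∀ i, IrrClass (GH i) → IrrClass (GG i))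
  (b : ∀ i : {i : ι // i ∉ S}, heckeAlgebra ℂ (GG i.1) (KG i.1) →ₐ[ℂ] heckeAlgebra ℂ (GH i.1) (KH i.1))

/-- **`IsXiHDual`: the dual Hecke maps `b_v` are COMPATIBLE WITH THE LIFT of unramified classes** — Rogawski's defining property of `η̂ = ξ̂_H` (§4.5 p. 46:
«`Tr(π_{χ′}(η̂(f))) = Tr(π_χ(f))` if `π_{χ′}` maps to `π_χ`») read on the spherical lines with the characters of ★ p855362: for every `v ∉ S`, every
`K_{H,v}`-spherical class `ρ_v` of `H_v` with `K_{G,v}`-spherical lift, and every `f ∈ ℋ(G_v, K_{G,v})`, `χ_{lift ρ_v}(op f) = χ_{ρ_v}(op (b_v f))`.  A predicate on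
the NAMED data `(lift, b)`; print supplies both through the Satake isomorphism.  (A predicate with parameters — the data `GG, GH, KG, KH, lift, b` — not a
named fact; print: Rogawski1990 §4.5 p. 46; CartierCorvallis1979 §IV.1 Cor. 4.2.) -/
def IsXiHDual : Prop :=
  ∀ (i : {i : ι // i ∉ S}) (ρ : IrrClass (GH i.1)) (hρ : ρ.IsSpherical (KH i.1)) (hl : (lift i.1 ρ).IsSpherical (KG i.1))
    (f : heckeAlgebra ℂ (GG i.1) (KG i.1)),
    classSphericalCharacter (KG i.1) (lift i.1 ρ) hl (MulOpposite.op f) = classSphericalCharacter (KH i.1) ρ hρ (MulOpposite.op (b i f))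

variable {GG GH KG KH lift b}

omit [∀ i, TopologicalSpace (GG i)] [∀ i, TopologicalSpace (GH i)] in
/-- The `ᵐᵒᵖ`-reading of the dual maps (★ p855362's `evp` is valued in characters of `ℋᵐᵒᵖ`): `b_v` as `ℋ(G_v)ᵐᵒᵖ →ₐ ℋ(H_v)ᵐᵒᵖ`. [cite: Rogawski1990, §4.5 p. 46] -/
def bOp (b : ∀ i : {i : ι // i ∉ S}, heckeAlgebra ℂ (GG i.1) (KG i.1) →ₐ[ℂ] heckeAlgebra ℂ (GH i.1) (KH i.1)) (i : {i : ι // i ∉ S}) :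
    (heckeAlgebra ℂ (GG i.1) (KG i.1))ᵐᵒᵖ →ₐ[ℂ] (heckeAlgebra ℂ (GH i.1) (KH i.1))ᵐᵒᵖ :=
  AlgHom.op (b i)

omit [∀ i, TopologicalSpace (GG i)] [∀ i, TopologicalSpace (GH i)] in
/-- Unfolding: `bOp b v (op f) = op (b_v f)`. [cite: Rogawski1990, §4.5 p. 46] -/
@[simp] theorem bOp_apply_op (b : ∀ i : {i : ι // i ∉ S}, heckeAlgebra ℂ (GG i.1) (KG i.1) →ₐ[ℂ] heckeAlgebra ℂ (GH i.1) (KH i.1))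
    (i : {i : ι // i ∉ S}) (f : heckeAlgebra ℂ (GG i.1) (KG i.1)) :
    bOp b i (MulOpposite.op f) = MulOpposite.op (b i f) :=
  rfl

/-- **THE LAW `t(lift ∘ ρ) = ψ_G(t(ρ))`**: under `IsXiHDual`, for a family `ρ = (ρ_v)_v` of classes of the `H_v`, `K_{H,v}`-spherical off `S` with `K_{G,v}`-spherical
lifts, the eigenvalue package of the LIFTED family (★ p855362 `evp`) is the transfer along the dual maps of the eigenvalue package of `ρ` — the content of
«`ψ_G(t(ρ)) = t`» in (13.8.3)'s index set (Rogawski §13.8 p. 218). [cite: Rogawski1990, §13.6 p. 209 and §13.8 p. 218] -/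
theorem evp_lift_eq_psiG_evp (hdual : IsXiHDual GG GH KG KH lift b) (ρ : ∀ i, IrrClass (GH i))
    (hρ : ∀ i, i ∉ S → (ρ i).IsSpherical (KH i)) (hl : ∀ i, i ∉ S → (lift i (ρ i)).IsSpherical (KG i)) :
    evp GG KG (fun i => lift i (ρ i)) S hl = psiG (bOp b) (evp GH KH ρ S hρ) := by
  funext i
  apply AlgHom.ext
  intro T
  induction T using MulOpposite.rec' with
  | h f =>
    rw [psiG_apply, bOp_apply_op, evp_apply, evp_apply, ← classSphericalCharacter_apply (KG i.1) (lift i.1 (ρ i.1)) (hl i.1 i.2),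
      ← classSphericalCharacter_apply (KH i.1) (ρ i.1) (hρ i.1 i.2)]
    exact hdual i (ρ i.1) (hρ i.1 i.2) (hl i.1 i.2) f

/-- Hence **`t(lift ∘ ρ)^∧(f) = t(ρ)^∧(b f)`** for every pure tensor `f = ⊗_{v ∉ S} f_v`, `f_v ∈ ℋ(G_v, K_{G,v})ᵐᵒᵖ`. [cite: Rogawski1990, §13.6 p. 209] -/
theorem hat_evp_lift (hdual : IsXiHDual GG GH KG KH lift b) (ρ : ∀ i, IrrClass (GH i))
    (hρ : ∀ i, i ∉ S → (ρ i).IsSpherical (KH i)) (hl : ∀ i, i ∉ S → (lift i (ρ i)).IsSpherical (KG i))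
    (f : ∀ i : {i : ι // i ∉ S}, (heckeAlgebra ℂ (GG i.1) (KG i.1))ᵐᵒᵖ) :
    (evp GG KG (fun i => lift i (ρ i)) S hl).hat f = (evp GH KH ρ S hρ).hat fun i => bOp b i (f i) := by
  rw [evp_lift_eq_psiG_evp hdual ρ hρ hl, hat_psiG]

end Dual

end Summit.HodgeConjecture.HodgeConjecture.Cruxes.H413.K2E1EvpTransferXiH

end
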